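import Summits.QuantumFields.GaugeBoot.NonBacktrackingLoopVariables
import Summits.QuantumFields.GaugeBoot.FreeSubgroupSO3
import HarnessLib

/-!
# Free configurations for every gauge group containing a free pair: `SU(N)`, `U(N)` (`N ≥ 2`), `SO(N)` (`N ≥ 3`) (gauge-boot, large-`N` supplement 16, part 7)

HONEST FRAMING (cell `pub-gaugeboot`, page 1 of every file): the venture produces certified bounds
on lattice expectations at stated coupling, gauge group, dimension and torus size; NOT a mass gap,
NOT a continuum limit, NOT a string tension; NOT large `N` unless marked CONDITIONAL; NOT
Yang–Mills-summit-bearing (barriers `FixedCouplingUltralocality`, `PerturbativeInvisibility`).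
Group theory and lattice combinatorics; this file certifies no number.

## Content

Parts 2–4 were written for `SU(2+k)`.  The lattice statements only use ONE thing about the gauge group:
an injective homomorphism `FreeGroup ℕ →* G` — equivalently (`exists_freeGroup_nat_of_pair`) an injective
`FreeGroup (Fin 2) →* G`, a FREE PAIR.  This file states them for every such `G` and instantiates.

* `freeGenNat n = x₀^{n+1} x₁ x₀^{n+1} ∈ F₂` and ★ `lift_freeGenNat_injective` — `FreeGroup ℕ ↪ FreeGroup (Fin 2)`
  (a free-group fact, read off part 1b through the injective `F₂ → SU(2)`); `exists_freeGroup_nat_of_pair`.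
* `freeConfigOf d φ : LGConfig d G` (link of axis `μ` carries `φ (of μ)`); `wordHolonomyZd_freeConfigOf`
  (`hol_x(w) = φ(mk (code w))`), `walkHolonomy_freeConfigOf`; for injective `φ`:
  ★★ `wordHolonomyZd_freeConfigOf_eq_iff` (reduced words separated), `wordHolonomyZd_freeConfigOf_ne_one`,
  `walkHolonomy_freeConfigOf_ne_one`.
* For a group with a free pair `ψ` (`FreePair` data = an injective `FreeGroup (Fin 2) →* G`, passed as two
  arguments): ★★ `exists_config_walkHolonomy_ne_one_of_freePair` (no non-backtracking closed walk has
  holonomy `≡ 1`), `exists_config_wordHolonomyZd_ne_one_of_freePair`, `eq_of_forall_wordHolonomyZd_eq_of_freePair`,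
  ★★★ `exists_isNonBacktrackingLoop_realising_iff_of_freePair` (the exact domain of the walk hypotheses:
  closed + cyclically reduced), `not_exists_isNonBacktrackingLoop_realising_plaqWord_self_of_freePair`.
* INSTANCES: `freePairSU` (`SU(N)`, `N ≥ 2`, parts 1–2), `freePairU` (`U(N) = Matrix.unitaryGroup (Fin N) ℂ`,
  `N ≥ 2`, through `SU(N) ≤ U(N)`), `freePairSO` (`SO(N)`, `N ≥ 3`, part 6); e.g. ★★
  `exists_config_walkHolonomy_ne_one_SO` / `_U`, `exists_isNonBacktrackingLoop_realising_iff_SO` / `_U`.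

So Shen–Zhu–Zhu's non-backtracking hypotheses have the same exact domain for all three families
(`SU(N)`, `SO(N)`, `U(N)`) the tree types their facts for.  NOT covered (no free pair): `U(1)`, `SO(2)`,
finite and, more generally, virtually solvable gauge groups — there non-trivial words with holonomy `≡ 1`
exist (e.g. commutator loops for abelian `G`).  [folklore] (Hausdorff 1914, Tits 1972; lattice bookkeeping ours).
-/

noncomputable section

open SimpleGraph
open Literature.Probability.LatticeModels (Site zdGraph)
open Literature.MathematicalPhysics.QuantumLattice
open Literature.MathematicalPhysics.QuantumFieldTheory (IsNonBacktrackingLoop)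

namespace Summit.QuantumFields.GaugeBoot

variable {d : ℕ}

/-! ## `FreeGroup ℕ ↪ FreeGroup (Fin 2)` -/

/-- `x₀^{n+1} x₁ x₀^{n+1}` in the free group on two letters. [folklore] -/
def freeGenNat (n : ℕ) : FreeGroup (Fin 2) := FreeGroup.of 0 ^ (n + 1) * FreeGroup.of 1 * FreeGroup.of 0 ^ (n + 1)

/-- Through `F₂ → SU(2)` (`0 ↦ A`, `1 ↦ B`) the `freeGenNat n` become part 1b's `g_n = A^{n+1} B A^{n+1}`. [folklore] -/
theorem lift_gen_comp_lift_freeGenNat :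
    (FreeGroup.lift FreeSU2.gen).comp (FreeGroup.lift freeGenNat) = FreeGroup.lift FreeSU2.genNat := by
  ext n
  simp [freeGenNat, FreeSU2.genNat, FreeSU2.gen]

/-- ★ **`FreeGroup ℕ →* FreeGroup (Fin 2)`, `n ↦ x₀^{n+1} x₁ x₀^{n+1}`, is injective** (the free group of rank two
contains one of countably infinite rank) — read off part 1b. [folklore] -/
theorem lift_freeGenNat_injective : Function.Injective (FreeGroup.lift freeGenNat) := by
  have h := FreeSU2.lift_genNat_injective
  rw [← lift_gen_comp_lift_freeGenNat, MonoidHom.coe_comp] at h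
  exact h.of_comp

/-- **A free pair gives a free sequence**: from an injective `FreeGroup (Fin 2) →* G`, an injective
`FreeGroup ℕ →* G`. [folklore] -/
theorem exists_freeGroup_nat_of_pair {G : Type*} [Group G] (ψ : FreeGroup (Fin 2) →* G) (hψ : Function.Injective ψ) :
    ∃ φ : FreeGroup ℕ →* G, Function.Injective φ :=
  ⟨ψ.comp (FreeGroup.lift freeGenNat), by rw [MonoidHom.coe_comp]; exact hψ.comp lift_freeGenNat_injective⟩

/-! ## The free configuration of an embedding `FreeGroup ℕ →* G` -/

section Generic

variable {G : Type*} [Group G]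

/-- **The free configuration of `φ : FreeGroup ℕ →* G`**: every link of axis `μ` carries `φ (of μ)`. [folklore] -/
def freeConfigOf (d : ℕ) (φ : FreeGroup ℕ →* G) : LGConfig d G := fun e => φ (FreeGroup.of e.2.val)

/-- A step's holonomy on the free configuration. [folklore] -/
theorem stepHolonomyZd_freeConfigOf (φ : FreeGroup ℕ →* G) (x : Site d) (s : Step d) :
    stepHolonomyZd (freeConfigOf d φ) x s = φ (FreeGroup.mk [stepCode s]) := by
  cases s with
  | fwd μ => rfl
  | bwd μ =>
    rw [stepHolonomyZd_bwd, freeConfigOf, ← map_inv]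
    rfl

/-- **A word's holonomy on the free configuration is `φ` of its `FreeGroup ℕ` word.** [folklore] -/
theorem wordHolonomyZd_freeConfigOf (φ : FreeGroup ℕ →* G) : ∀ (x : Site d) (w : Word d),
    wordHolonomyZd (freeConfigOf d φ) x w = φ (FreeGroup.mk (w.map stepCode))
  | x, [] => by rw [wordHolonomyZd_nil, List.map_nil, ← FreeGroup.one_eq_mk, map_one]
  | x, s :: w => by
    rw [wordHolonomyZd_cons, wordHolonomyZd_freeConfigOf φ (s.applyZd x) w, stepHolonomyZd_freeConfigOf, ← map_mul,
      FreeGroup.mul_mk, List.map_cons, List.singleton_append]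

/-- **A walk's holonomy on the free configuration is `φ` of its dart word.** [folklore] -/
theorem walkHolonomy_freeConfigOf (φ : FreeGroup ℕ →* G) {x y : Site d} (γ : (zdGraph d).Walk x y) :
    walkHolonomy (freeConfigOf d φ) γ = φ (FreeGroup.mk (γ.darts.map dartCode)) := by
  rw [← wordHolonomyZd_walkWordZd, wordHolonomyZd_freeConfigOf, walkWordZd, List.map_map]
  simp only [Function.comp_def, stepCode_dartToStep]

/-- Two reduced `FreeGroup` words with the same class are equal. [folklore] -/
theorem eq_of_mk_eq_mk_of_isReduced {α : Type*} [DecidableEq α] {L L' : List (α × Bool)} (h : FreeGroup.IsReduced L)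
    (h' : FreeGroup.IsReduced L') (e : FreeGroup.mk L = FreeGroup.mk L') : L = L' := by
  have := congrArg FreeGroup.toWord e
  rwa [FreeGroup.toWord_mk, FreeGroup.toWord_mk, h.reduce_eq, h'.reduce_eq] at this

/-- ★★ **Reduced words are separated by the free configuration of an INJECTIVE `φ`.** [folklore] -/
theorem wordHolonomyZd_freeConfigOf_eq_iff {φ : FreeGroup ℕ →* G} (hφ : Function.Injective φ) (x : Site d) {w w' : Word d}
    (hred : w.IsChain (fun s t => t ≠ s.inv)) (hred' : w'.IsChain (fun s t => t ≠ s.inv)) :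
    wordHolonomyZd (freeConfigOf d φ) x w = wordHolonomyZd (freeConfigOf d φ) x w' ↔ w = w' := by
  refine ⟨fun h => ?_, fun h => by rw [h]⟩
  rw [wordHolonomyZd_freeConfigOf, wordHolonomyZd_freeConfigOf] at h
  exact (List.map_injective_iff.2 stepCode_injective)
    (eq_of_mk_eq_mk_of_isReduced (isReduced_map_stepCode hred) (isReduced_map_stepCode hred') (hφ h))

/-- ★★ **On the free configuration of an injective `φ` every non-empty reduced word has holonomy `≠ 1`.** [folklore] -/
theorem wordHolonomyZd_freeConfigOf_ne_one {φ : FreeGroup ℕ →* G} (hφ : Function.Injective φ) (x : Site d) {w : Word d}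
    (hw : w ≠ []) (hred : w.IsChain (fun s t => t ≠ s.inv)) : wordHolonomyZd (freeConfigOf d φ) x w ≠ 1 := by
  rw [← wordHolonomyZd_nil (freeConfigOf d φ) x, Ne, wordHolonomyZd_freeConfigOf_eq_iff hφ x hred List.IsChain.nil]
  exact hw

/-- ★★ **… and every walk of positive length whose consecutive darts do not backtrack has holonomy `≠ 1`.** [folklore] -/
theorem walkHolonomy_freeConfigOf_ne_one {φ : FreeGroup ℕ →* G} (hφ : Function.Injective φ) {x y : Site d}
    (γ : (zdGraph d).Walk x y) (hlen : 0 < γ.length) (hnb : γ.darts.IsChain (fun a b => b ≠ a.symm)) :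
    walkHolonomy (freeConfigOf d φ) γ ≠ 1 := by
  rw [← wordHolonomyZd_walkWordZd]
  refine wordHolonomyZd_freeConfigOf_ne_one hφ x ?_ ((isChain_map_dartToStep_iff γ.isChain_dartAdj_darts).2 hnb)
  rw [Ne, ← List.length_eq_zero_iff, length_walkWordZd]
  omega

end Generic

/-! ## Gauge groups with a free pair -/

section FreePair

variable {G : Type*} [Group G]

/-- ★★ **A gauge group with a free pair: no non-backtracking closed walk has holonomy identically `1`.** [folklore] -/
theorem exists_config_walkHolonomy_ne_one_of_freePair (ψ : FreeGroup (Fin 2) →* G) (hψ : Function.Injective ψ)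
    {x : Site d} (γ : (zdGraph d).Walk x x) (hγ : IsNonBacktrackingLoop γ) : ∃ U : LGConfig d G, walkHolonomy U γ ≠ 1 := by
  obtain ⟨φ, hφ⟩ := exists_freeGroup_nat_of_pair ψ hψ
  exact ⟨freeConfigOf d φ, walkHolonomy_freeConfigOf_ne_one hφ γ hγ.1 hγ.2.left_of_append⟩

/-- **… no non-empty reduced word has holonomy identically `1`.** [folklore] -/
theorem exists_config_wordHolonomyZd_ne_one_of_freePair (ψ : FreeGroup (Fin 2) →* G) (hψ : Function.Injective ψ)
    (x : Site d) {w : Word d} (hw : w ≠ []) (hred : w.IsChain (fun s t => t ≠ s.inv)) :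
    ∃ U : LGConfig d G, wordHolonomyZd U x w ≠ 1 := by
  obtain ⟨φ, hφ⟩ := exists_freeGroup_nat_of_pair ψ hψ
  exact ⟨freeConfigOf d φ, wordHolonomyZd_freeConfigOf_ne_one hφ x hw hred⟩

/-- **… reduced words with the same holonomy function are equal.** [folklore] -/
theorem eq_of_forall_wordHolonomyZd_eq_of_freePair (ψ : FreeGroup (Fin 2) →* G) (hψ : Function.Injective ψ) (x : Site d)
    {w w' : Word d} (hred : w.IsChain (fun s t => t ≠ s.inv)) (hred' : w'.IsChain (fun s t => t ≠ s.inv))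
    (h : ∀ U : LGConfig d G, wordHolonomyZd U x w = wordHolonomyZd U x w') : w = w' := by
  obtain ⟨φ, hφ⟩ := exists_freeGroup_nat_of_pair ψ hψ
  exact (wordHolonomyZd_freeConfigOf_eq_iff hφ x hred hred').1 (h (freeConfigOf d φ))

/-- ★★★ **The exact domain of the walk hypotheses, for every gauge group with a free pair**: a reduced word
`w` is realised by a non-backtracking closed walk (same holonomy on every configuration) iff `w` is closed
and cyclically reduced. [folklore] -/
theorem exists_isNonBacktrackingLoop_realising_iff_of_freePair (ψ : FreeGroup (Fin 2) →* G) (hψ : Function.Injective ψ)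
    (x : Site d) {w : Word d} (hred : w.IsChain (fun s t => t ≠ s.inv)) :
    (∃ γ : (zdGraph d).Walk x x, IsNonBacktrackingLoop γ ∧ ∀ U : LGConfig d G, walkHolonomy U γ = wordHolonomyZd U x w) ↔
      Word.endpointZd x w = x ∧ w.CyclicallyReduced := by
  constructor
  · rintro ⟨γ, hγ, hhol⟩
    have hcr : (walkWordZd γ).CyclicallyReduced := (cyclicallyReduced_walkWordZd_iff γ).2 hγ
    have heq : walkWordZd γ = w := eq_of_forall_wordHolonomyZd_eq_of_freePair ψ hψ x hcr.2.left_of_append hred fun U => by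
      rw [wordHolonomyZd_walkWordZd, hhol U]
    subst heq
    exact ⟨endpointZd_walkWordZd γ, hcr⟩
  · rintro ⟨hx, hcr⟩
    exact ⟨Word.toLoopZd x w hx, isNonBacktrackingLoop_toLoopZd x w hx hcr, fun U => walkHolonomy_toLoopZd U x w hx⟩

/-- **The erratum of supplement 9, for every gauge group with a free pair**: no non-backtracking closed walk
realises the degenerate plaquette word `plaqWord a a ε`. [folklore] -/
theorem not_exists_isNonBacktrackingLoop_realising_plaqWord_self_of_freePair (ψ : FreeGroup (Fin 2) →* G)
    (hψ : Function.Injective ψ) (x : Site d) (a : Fin d) (ε : Bool) :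
    ¬ ∃ γ : (zdGraph d).Walk x x, IsNonBacktrackingLoop γ ∧ ∀ U : LGConfig d G, walkHolonomy U γ = wordHolonomyZd U x (plaqWord a a ε) := by
  rintro ⟨γ, hγ, hhol⟩
  obtain ⟨U, hU⟩ := exists_config_walkHolonomy_ne_one_of_freePair ψ hψ γ hγ
  exact hU ((hhol U).trans (wordHolonomyZd_plaqWord_self U x a ε))

end FreePair

/-! ## Instances: `SU(N)` (`N ≥ 2`), `U(N)` (`N ≥ 2`), `SO(N)` (`N ≥ 3`) -/

/-- **`SU(N)`, `N ≥ 2`, has a free pair** (parts 1–2: `diag(A, 1), diag(B, 1)`). [folklore] -/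
theorem freePairSU {N : ℕ} (hN : 2 ≤ N) : ∃ ψ : FreeGroup (Fin 2) →* SU N, Function.Injective ψ := by
  obtain ⟨k, rfl⟩ := Nat.exists_eq_add_of_le hN
  exact ⟨(blockEmb k).comp (FreeGroup.lift FreeSU2.gen), by
    rw [MonoidHom.coe_comp]; exact (blockEmb_injective k).comp FreeSU2.lift_gen_injective⟩

/-- `SU(N) ≤ U(N)` as an injective homomorphism (Mathlib `Submonoid.inclusion`). [folklore] -/
def suToU (N : ℕ) : SU N →* Matrix.unitaryGroup (Fin N) ℂ := Submonoid.inclusion Matrix.specialUnitaryGroup_le_unitaryGroup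

/-- The inclusion `SU(N) → U(N)` is injective. [folklore] -/
theorem suToU_injective (N : ℕ) : Function.Injective (suToU N) :=
  Submonoid.inclusion_injective Matrix.specialUnitaryGroup_le_unitaryGroup

/-- **`U(N)`, `N ≥ 2`, has a free pair** (through `SU(N) ≤ U(N)`). [folklore] -/
theorem freePairU {N : ℕ} (hN : 2 ≤ N) : ∃ ψ : FreeGroup (Fin 2) →* Matrix.unitaryGroup (Fin N) ℂ, Function.Injective ψ := by
  obtain ⟨ψ, hψ⟩ := freePairSU hN
  exact ⟨(suToU N).comp ψ, by rw [MonoidHom.coe_comp]; exact (suToU_injective N).comp hψ⟩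

/-- **`SO(N)`, `N ≥ 3`, has a free pair** (part 6: `diag(R_z, 1), diag(R_x, 1)`). [folklore] -/
theorem freePairSO {N : ℕ} (hN : 3 ≤ N) : ∃ ψ : FreeGroup (Fin 2) →* SO N, Function.Injective ψ :=
  exists_freeGroup_pair_embedding_SO hN

/-- ★★ **`SO(N)`, `N ≥ 3`: no non-backtracking closed walk has holonomy identically `1`.** [folklore] -/
theorem exists_config_walkHolonomy_ne_one_SO {N : ℕ} (hN : 3 ≤ N) {x : Site d} (γ : (zdGraph d).Walk x x)
    (hγ : IsNonBacktrackingLoop γ) : ∃ U : LGConfig d (SO N), walkHolonomy U γ ≠ 1 := by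
  obtain ⟨ψ, hψ⟩ := freePairSO hN
  exact exists_config_walkHolonomy_ne_one_of_freePair ψ hψ γ hγ

/-- ★★ **`U(N)`, `N ≥ 2`: no non-backtracking closed walk has holonomy identically `1`.** [folklore] -/
theorem exists_config_walkHolonomy_ne_one_U {N : ℕ} (hN : 2 ≤ N) {x : Site d} (γ : (zdGraph d).Walk x x)
    (hγ : IsNonBacktrackingLoop γ) : ∃ U : LGConfig d (Matrix.unitaryGroup (Fin N) ℂ), walkHolonomy U γ ≠ 1 := by
  obtain ⟨ψ, hψ⟩ := freePairU hN
  exact exists_config_walkHolonomy_ne_one_of_freePair ψ hψ γ hγ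

/-- ★★★ **`SO(N)`, `N ≥ 3`: the exact domain of the walk hypotheses** (closed + cyclically reduced). [folklore] -/
theorem exists_isNonBacktrackingLoop_realising_iff_SO {N : ℕ} (hN : 3 ≤ N) (x : Site d) {w : Word d}
    (hred : w.IsChain (fun s t => t ≠ s.inv)) :
    (∃ γ : (zdGraph d).Walk x x, IsNonBacktrackingLoop γ ∧ ∀ U : LGConfig d (SO N), walkHolonomy U γ = wordHolonomyZd U x w) ↔
      Word.endpointZd x w = x ∧ w.CyclicallyReduced := by
  obtain ⟨ψ, hψ⟩ := freePairSO hN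
  exact exists_isNonBacktrackingLoop_realising_iff_of_freePair ψ hψ x hred

/-- ★★★ **`U(N)`, `N ≥ 2`: the exact domain of the walk hypotheses** (closed + cyclically reduced). [folklore] -/
theorem exists_isNonBacktrackingLoop_realising_iff_U {N : ℕ} (hN : 2 ≤ N) (x : Site d) {w : Word d}
    (hred : w.IsChain (fun s t => t ≠ s.inv)) :
    (∃ γ : (zdGraph d).Walk x x, IsNonBacktrackingLoop γ ∧
        ∀ U : LGConfig d (Matrix.unitaryGroup (Fin N) ℂ), walkHolonomy U γ = wordHolonomyZd U x w) ↔
      Word.endpointZd x w = x ∧ w.CyclicallyReduced := by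
  obtain ⟨ψ, hψ⟩ := freePairU hN
  exact exists_isNonBacktrackingLoop_realising_iff_of_freePair ψ hψ x hred

/-- **`SO(N)`, `N ≥ 3`: reduced words with the same holonomy function are equal.** [folklore] -/
theorem eq_of_forall_wordHolonomyZd_eq_SO {N : ℕ} (hN : 3 ≤ N) (x : Site d) {w w' : Word d}
    (hred : w.IsChain (fun s t => t ≠ s.inv)) (hred' : w'.IsChain (fun s t => t ≠ s.inv))
    (h : ∀ U : LGConfig d (SO N), wordHolonomyZd U x w = wordHolonomyZd U x w') : w = w' := by
  obtain ⟨ψ, hψ⟩ := freePairSO hN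
  exact eq_of_forall_wordHolonomyZd_eq_of_freePair ψ hψ x hred hred' h

/-- **`SO(N)`, `N ≥ 3`: the degenerate plaquette word is realised by no non-backtracking closed walk.** [folklore] -/
theorem not_exists_isNonBacktrackingLoop_realising_plaqWord_self_SO {N : ℕ} (hN : 3 ≤ N) (x : Site d) (a : Fin d) (ε : Bool) :
    ¬ ∃ γ : (zdGraph d).Walk x x, IsNonBacktrackingLoop γ ∧
      ∀ U : LGConfig d (SO N), walkHolonomy U γ = wordHolonomyZd U x (plaqWord a a ε) := by
  obtain ⟨ψ, hψ⟩ := freePairSO hN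
  exact not_exists_isNonBacktrackingLoop_realising_plaqWord_self_of_freePair ψ hψ x a ε

end Summit.QuantumFields.GaugeBoot

end
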